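import Summits.Ventures.HodgeRepro2.T5InertDegreePrinted
import Summits.Ventures.HodgeRepro2.T5GaloisCartanThree

/-!
# The degree count on seat p8's Galois package: `deg Tₙ = (q³ + 1) q^{4n−3}` for `(R₀, F, E, τ)`
(cell pub-hodge-repro2, seat p3)

Tier-5 N3 support. Seat p8's T5-127 (`T5GaloisCartanThree`) reads the inert-place Hecke package for
`U(antidiag(1, u, 1))` on the GALOIS data of the record: `R₀` a DVR with fraction field `F`, `E/F` with an
`F`-automorphism `τ` (the conjugation), `𝒪_E := integralClosure R₀ E` a DVR with finite residue field,
`hunr : 𝔭_{R₀} 𝒪_E = 𝔭_{𝒪_E}` (`e = 1`), `u ∈ R₀ˣ`, `ϖ ∈ R₀` irreducible, and a star on `E` with `star = τ`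
(p8's `starRingOfInvolution`: `star_eq`). This file instantiates files 195–204 on that package, for ANY star
instance with `star x = τ x`:

* `hstar_of_star_eq`, `star_algebraMap_of_star_eq` — the standing hypotheses `hstar`, `hsu`, `hs` from `star = τ`;
* **`ncard_orbit_cellU_eq_galois`** — `deg Tₙ = #(K aₙ K / K) = (q³ + 1) q^{4n−3}` (`n ≥ 1`) with
  `q = #{t ∈ 𝒪_E/ϖ : t + τ̄ t = 0}`, given `ResidueConjNontrivial τ ϖ : ∃ x ∈ 𝒪_E, x − τ x ∉ ϖ 𝒪_E` (the residue
  involution is non-trivial — the inert case; on Mathlib's completions p8's T5-170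
  `mapAlgEquiv'_galRestrict_ne_one`);
* **`mul_cellU_eq_galois`** / **`mul_cellU_one_eq_galois`** — the tree recursion of `H(U(2,1), K)` on the same
  package, with no degree hypothesis.

Mathlib + this seat's file 203 + p8's T5-127 and their imports; no display; no device.
§8(d): uses an L-value-free non-vanishing device: NO.
-/

namespace Summit.Ventures.HodgeRepro2.T5InertDegreeGalois

open Summit.Ventures.HodgeRepro2.T5HermitianThreeElements Summit.Ventures.HodgeRepro2.T5UnitaryGroupForm
  Summit.Ventures.HodgeRepro2.T5UnitaryHeckeAdjoint Summit.Ventures.HodgeRepro2.T5HeckeBasisCells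
  Summit.Ventures.HodgeRepro2.T5StarOfInvolution Summit.Ventures.HodgeRepro2.T5GaloisCartanThree
  Summit.Ventures.HodgeRepro2.T5InertUnipotentResidue Summit.Ventures.HodgeRepro2.T5InertDegreePrinted

section Galois

variable {R₀ F E : Type*} [CommRing R₀] [IsDomain R₀] [IsDiscreteValuationRing R₀] [Field F] [Field E]
  [Algebra R₀ F] [IsFractionRing R₀ F] [Algebra F E] [Algebra R₀ E] [IsScalarTower R₀ F E]
  (τ : E ≃ₐ[F] E) [StarRing E] (hst : ∀ x : E, star x = τ x)

omit [IsDomain R₀] [IsDiscreteValuationRing R₀] [IsFractionRing R₀ F] in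
include hst in
/-- `hstar` for `𝒪_E`: the star preserves integrality (`τ` maps the integral closure into itself). -/
theorem hstar_of_star_eq (x : E) (hx : IsLocalization.IsInteger (integralClosure R₀ E) x) :
    IsLocalization.IsInteger (integralClosure R₀ E) (star x) := by
  rw [isInteger_integralClosure_iff] at hx ⊢
  rw [hst]
  exact map_mem_integralClosure τ hx

omit [IsDomain R₀] [IsDiscreteValuationRing R₀] [IsFractionRing R₀ F] in
include hst in
/-- The star fixes the image of `R₀`. -/
theorem star_algebraMap_of_star_eq (r : R₀) : star (algebraMap R₀ E r) = algebraMap R₀ E r := by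
  rw [hst, IsScalarTower.algebraMap_apply R₀ F E, AlgEquiv.commutes]

variable [IsDiscreteValuationRing (integralClosure R₀ E)] [Finite (IsLocalRing.ResidueField (integralClosure R₀ E))]
  [IsFractionRing (integralClosure R₀ E) E]
  (hunr : Ideal.map (algebraMap R₀ (integralClosure R₀ E)) (IsLocalRing.maximalIdeal R₀) =
    IsLocalRing.maximalIdeal (integralClosure R₀ E))
  (u : R₀ˣ) {ϖ : R₀} (hϖ : Irreducible ϖ)

/-- The non-triviality of the residue involution, in the vocabulary of the Galois package: an integral `x` with
`x − τ x ∉ ϖ₀ 𝒪_E`. -/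
def ResidueConjNontrivial (ϖ₀ : R₀) : Prop :=
  ∃ x : integralClosure R₀ E, ¬ IsLocalization.IsInteger (integralClosure R₀ E)
    ((algebraMap (integralClosure R₀ E) E x - τ (algebraMap (integralClosure R₀ E) E x)) *
      (algebraMap (integralClosure R₀ E) E (algebraMap R₀ (integralClosure R₀ E) ϖ₀))⁻¹)

omit [IsDomain R₀] [IsDiscreteValuationRing R₀] [Algebra R₀ F] [IsFractionRing R₀ F] [IsScalarTower R₀ F E]
  [IsDiscreteValuationRing (integralClosure R₀ E)]
  [Finite (IsLocalRing.ResidueField (integralClosure R₀ E))] [IsFractionRing (integralClosure R₀ E) E] in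
include hst in
/-- `ResidueConjNontrivial` is the hypothesis `hnt` of file 203. -/
theorem hnt_of_residueConjNontrivial (hnt : ResidueConjNontrivial τ ϖ) :
    ∃ x : integralClosure R₀ E, ¬ IsLocalization.IsInteger (integralClosure R₀ E)
      ((algebraMap (integralClosure R₀ E) E x - star (algebraMap (integralClosure R₀ E) E x)) *
        (algebraMap (integralClosure R₀ E) E (algebraMap R₀ (integralClosure R₀ E) ϖ))⁻¹) := by
  obtain ⟨x, hx⟩ := hnt
  exact ⟨x, by rw [hst]; exact hx⟩

include hst hunr in
/-- **`deg Tₙ = (q³ + 1) q^{4n−3}` on the Galois package** (`n ≥ 1`), `q = #{t ∈ 𝒪_E/ϖ : t + τ̄ t = 0}`. -/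
theorem ncard_orbit_cellU_eq_galois (hnt : ResidueConjNontrivial τ ϖ) (n : ℕ) (hn : 1 ≤ n) :
    (MulAction.orbit (hyperspecialSubgroup (integralClosure R₀ E) (J3 (algebraMap R₀ E (u : R₀))))
        ((cellU (irreducible_uniformiser hunr hϖ) (star_algebraMap_of_star_eq τ hst ϖ)
            (algebraMap R₀ E (u : R₀)) n : formUnitaryGroup (J3 (algebraMap R₀ E (u : R₀)))) :
          formUnitaryGroup (J3 (algebraMap R₀ E (u : R₀))) ⧸
            hyperspecialSubgroup (integralClosure R₀ E) (J3 (algebraMap R₀ E (u : R₀))))).ncard =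
      (Nat.card (traceZero (integralClosure R₀ E) E) ^ 3 + 1) *
        Nat.card (traceZero (integralClosure R₀ E) E) ^ (4 * n - 3) :=
  ncard_orbit_cellU_eq_inert (hstar_of_star_eq τ hst) (algebraMap R₀ E (u : R₀)) (star_algebraMap_of_star_eq τ hst (u : R₀))
    (algebraMap_unit_ne_zero (F := F) u) (isInteger_algebraMap (u : R₀)) (isInteger_algebraMap_unit_inv u)
    (irreducible_uniformiser hunr hϖ) (star_algebraMap_of_star_eq τ hst ϖ)
    (hnt_of_residueConjNontrivial τ hst hnt) n hn

variable (k : Type*) [Field k] [CharZero k]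

include hst hunr in
/-- **The tree recursion on the Galois package** (`n ≥ 1`, written with `n + 1`):
`T₁ · T_{n+1} = T_{n+2} + (q − 1) T_{n+1} + q⁴ Tₙ`. -/
theorem mul_cellU_eq_galois (hnt : ResidueConjNontrivial τ ϖ) (n : ℕ) :
    heckeBasisCells (hstar_of_star_eq τ hst) (algebraMap R₀ E (u : R₀)) (star_algebraMap_of_star_eq τ hst (u : R₀))
          (algebraMap_unit_ne_zero (F := F) u) (isInteger_algebraMap (u : R₀)) (isInteger_algebraMap_unit_inv u)
          (irreducible_uniformiser hunr hϖ) (star_algebraMap_of_star_eq τ hst ϖ) k 1 *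
        heckeBasisCells (hstar_of_star_eq τ hst) (algebraMap R₀ E (u : R₀)) (star_algebraMap_of_star_eq τ hst (u : R₀))
          (algebraMap_unit_ne_zero (F := F) u) (isInteger_algebraMap (u : R₀)) (isInteger_algebraMap_unit_inv u)
          (irreducible_uniformiser hunr hϖ) (star_algebraMap_of_star_eq τ hst ϖ) k (n + 1 + 1) =
      heckeBasisCells (hstar_of_star_eq τ hst) (algebraMap R₀ E (u : R₀)) (star_algebraMap_of_star_eq τ hst (u : R₀))
          (algebraMap_unit_ne_zero (F := F) u) (isInteger_algebraMap (u : R₀)) (isInteger_algebraMap_unit_inv u)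
          (irreducible_uniformiser hunr hϖ) (star_algebraMap_of_star_eq τ hst ϖ) k (n + 1 + 1 + 1) +
        ((Nat.card (traceZero (integralClosure R₀ E) E) : k) - 1) •
          heckeBasisCells (hstar_of_star_eq τ hst) (algebraMap R₀ E (u : R₀)) (star_algebraMap_of_star_eq τ hst (u : R₀))
            (algebraMap_unit_ne_zero (F := F) u) (isInteger_algebraMap (u : R₀)) (isInteger_algebraMap_unit_inv u)
            (irreducible_uniformiser hunr hϖ) (star_algebraMap_of_star_eq τ hst ϖ) k (n + 1 + 1) +
        (Nat.card (traceZero (integralClosure R₀ E) E) : k) ^ 4 •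
          heckeBasisCells (hstar_of_star_eq τ hst) (algebraMap R₀ E (u : R₀)) (star_algebraMap_of_star_eq τ hst (u : R₀))
            (algebraMap_unit_ne_zero (F := F) u) (isInteger_algebraMap (u : R₀)) (isInteger_algebraMap_unit_inv u)
            (irreducible_uniformiser hunr hϖ) (star_algebraMap_of_star_eq τ hst ϖ) k (n + 1) :=
  mul_cellU_eq_inert (hstar_of_star_eq τ hst) (algebraMap R₀ E (u : R₀)) (star_algebraMap_of_star_eq τ hst (u : R₀))
    (algebraMap_unit_ne_zero (F := F) u) (isInteger_algebraMap (u : R₀)) (isInteger_algebraMap_unit_inv u)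
    (irreducible_uniformiser hunr hϖ) (star_algebraMap_of_star_eq τ hst ϖ)
    (hnt_of_residueConjNontrivial τ hst hnt) k n

include hst hunr in
/-- **The tree recursion at `n = 0` on the Galois package**: `T₁² = T₂ + (q − 1) T₁ + (q⁴ + q) T₀`. -/
theorem mul_cellU_one_eq_galois (hnt : ResidueConjNontrivial τ ϖ) :
    heckeBasisCells (hstar_of_star_eq τ hst) (algebraMap R₀ E (u : R₀)) (star_algebraMap_of_star_eq τ hst (u : R₀))
          (algebraMap_unit_ne_zero (F := F) u) (isInteger_algebraMap (u : R₀)) (isInteger_algebraMap_unit_inv u)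
          (irreducible_uniformiser hunr hϖ) (star_algebraMap_of_star_eq τ hst ϖ) k 1 *
        heckeBasisCells (hstar_of_star_eq τ hst) (algebraMap R₀ E (u : R₀)) (star_algebraMap_of_star_eq τ hst (u : R₀))
          (algebraMap_unit_ne_zero (F := F) u) (isInteger_algebraMap (u : R₀)) (isInteger_algebraMap_unit_inv u)
          (irreducible_uniformiser hunr hϖ) (star_algebraMap_of_star_eq τ hst ϖ) k (0 + 1) =
      heckeBasisCells (hstar_of_star_eq τ hst) (algebraMap R₀ E (u : R₀)) (star_algebraMap_of_star_eq τ hst (u : R₀))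
          (algebraMap_unit_ne_zero (F := F) u) (isInteger_algebraMap (u : R₀)) (isInteger_algebraMap_unit_inv u)
          (irreducible_uniformiser hunr hϖ) (star_algebraMap_of_star_eq τ hst ϖ) k (0 + 1 + 1) +
        ((Nat.card (traceZero (integralClosure R₀ E) E) : k) - 1) •
          heckeBasisCells (hstar_of_star_eq τ hst) (algebraMap R₀ E (u : R₀)) (star_algebraMap_of_star_eq τ hst (u : R₀))
            (algebraMap_unit_ne_zero (F := F) u) (isInteger_algebraMap (u : R₀)) (isInteger_algebraMap_unit_inv u)
            (irreducible_uniformiser hunr hϖ) (star_algebraMap_of_star_eq τ hst ϖ) k (0 + 1) +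
        ((Nat.card (traceZero (integralClosure R₀ E) E) : k) ^ 4 +
            (Nat.card (traceZero (integralClosure R₀ E) E) : k)) •
          heckeBasisCells (hstar_of_star_eq τ hst) (algebraMap R₀ E (u : R₀)) (star_algebraMap_of_star_eq τ hst (u : R₀))
            (algebraMap_unit_ne_zero (F := F) u) (isInteger_algebraMap (u : R₀)) (isInteger_algebraMap_unit_inv u)
            (irreducible_uniformiser hunr hϖ) (star_algebraMap_of_star_eq τ hst ϖ) k 0 :=
  mul_cellU_one_eq_inert (hstar_of_star_eq τ hst) (algebraMap R₀ E (u : R₀)) (star_algebraMap_of_star_eq τ hst (u : R₀))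
    (algebraMap_unit_ne_zero (F := F) u) (isInteger_algebraMap (u : R₀)) (isInteger_algebraMap_unit_inv u)
    (irreducible_uniformiser hunr hϖ) (star_algebraMap_of_star_eq τ hst ϖ)
    (hnt_of_residueConjNontrivial τ hst hnt) k

end Galois

end Summit.Ventures.HodgeRepro2.T5InertDegreeGalois
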